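import Summits.MatrixMultiplication.MatrixMultiplication.Theorems.FarEdgeDescentChord
import Summits.MatrixMultiplication.MatrixMultiplication.Theorems.FarEdgeDescentLogRate
import HarnessLib

/-!
# Route `FarEdgeDescent` — the EXPONENTIAL FLOOR under the crux `AnchoredLogConvexity`
(stmt-MatrixMultiplication-28900) and the deeper cut `ω = 2 ⟺ SuperExpContact ∧ AnchoredLogConvexity`
(aside stmt-MatrixMultiplication-28901 in place of the special leaf `FiniteSaturation`, stmt-23739) — all PROVED

decomp-mm ROOT cell (D-0178), lens 2 «structural dichotomy: special vs generic», gen 17.  Write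
`e(x) := ω(1,x,1) − (x+1) ≥ 0` for the excess on the real shape axis `⟨n, n^x, n⟩`, `w := e(1) = ω − 2`,
`s := 3 − ω ≥ 0`.  The node of record is `ω = 2 ⟺ FiniteSaturation ∧ AnchoredLogConvexity`
(`FarEdgeDescentChord.node_iff`): a FAR ZERO of `e` (special) plus the anchored law `e(m)² ≤ e(1)·e(2m−1)`
(generic), which halves the zero down to the square.  This file prices the generic law QUANTITATIVELY and
thereby replaces the special leaf by the weakest contact statement that still closes:

* §0–§1 **EXPONENTIAL FLOOR (PROVED).** `AnchoredLogConvexity ∧ ω > 2 ⟹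
  e(K) ≥ (ω−2)·exp(−(3−ω)(K−1)/(ω−2))` for every real `K > 1` (`expFloor_of_alc`).  Mechanism: along the
  halving orbit `m_j = 1 + (K−1)/2^j` the law gives `e(K) ≥ w·(e(m_j)/w)^(2^j)` (`orbit_floor`);
  Lotti–Romani convexity through the ANCHOR `ω(1,0,1) = 2`
  gives the supporting line `e(m) ≥ w − s(m−1)` (`anchorLine_le_excess`); and `(1 − a/2^j)^(2^j) → exp(−a)`
  (Mathlib `Real.tendsto_one_add_div_pow_exp`).  The engine is abstract (`exp_floor`: any real profile `E`
  with the anchored law and a supporting line at the anchor value; `E ≥ 0` is not even used), so it can be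
  re-used on other axes.
  The constant is SHARP: the world `E(x) = w·exp(−λ(x−1))`, `λ ≤ s/w`, satisfies the anchored law with
  EQUALITY (`expWorld_law_eq`) and is the floor itself at `λ = s/w`.
* §2 **THE DEEPER CUT B′ (PROVED both ways).** `SuperExpContact` (`∀ ρ > 0, ∃ k ≥ 2, e(k) < ρ^k`, i.e.
  `liminf e(k)^{1/k} = 0`) and the anchored law decide the summit: `closes_expCut`, `node_expCut_iff :
  ω = 2 ⟺ SuperExpContact ∧ AnchoredLogConvexity`.  Under the law a world with `ω > 2` has
  `e(k) ≥ c·r^k` (`r = exp(−s/w) > 0`), so superexponential contact is impossible.  No integer slices, no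
  `RealLogConvexity` (the gen-6 cut B needed the full real three-term law; B′ needs only the anchored one):
  B′ ⟸ cut A (`FiniteSaturation ⟹ SuperExpContact`, `superExpContact_of_finiteSaturation`) and B′ ⟸ cut B
  (`RealLogConvexity ⟹ AnchoredLogConvexity`, `anchored_of_realLogConvexity`) — B′ dominates both.
* §3 **RUNGS AND SHARPNESS.** The `ρ`-ladder of the new special leaf has a PROVED first rung from tree data:
  `SuperExpContact` at every `ρ > √(log 2/log 6) ≈ 0.622` (`superExpContact_rung`, witness `k = 2`, landed
  aside `LogRate`); print lowers the threshold to `ρ > e(2)^{1/2}`, below `0.5006` (`ω(1,2,1) < 3.250563`,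
  Le Gall 2024, arXiv:2307.06535 p. 5; not vendored).  `SuperExpContact` is the MINIMAL contact rung
  against the anchored law: every exponential world (`expWorld_noContact`) obeys the law (and the profile
  facts used) and refutes it, so no fixed-rate contact statement
  closes; and it is STRICTLY WEAKER than `FiniteSaturation`: the zero-free world `E(k) = w·exp(−(k²−1))`
  has superexponential contact (`gaussWorld_contact`, `gaussWorld_noZero`) — and, consistently with §2,
  violates the law (`gaussWorld_not_law`).

Imports only BUILT modules (`FarEdgeDescentChord`, `FarEdgeDescentLogRate`); no new definitions; every
statement is about the TRUE exponents or about explicit model profiles.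
[cite: LottiRomani1983, §1 (p. 173), §2 (p. 174)] [cite: Coppersmith1982] [cite: HuangPan1998, §8]
-/

set_option linter.dupNamespace false

noncomputable section

namespace Summit.MatrixMultiplication.MatrixMultiplication.Theorems.FarEdgeDescentExpFloor

open Literature.Computability.AlgebraicComplexity
open Summit.MatrixMultiplication.MatrixMultiplication.Theses.FarEdgeDescent
open Summit.MatrixMultiplication.MatrixMultiplication.Theorems.FarEdgeDescentChord
open Filter Topology

/-! ## §0 The abstract engine: anchored law + supporting line ⟹ exponential floor -/

/-- **Orbit floor (abstract).** For a profile `E` on `[1,∞)` obeying the anchored law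
`E(m)² ≤ w·E(2m−1)` (`m > 1`) with anchor value `w > 0`, the halving orbit `m_j = 1 + (K−1)/2^j` of a shape
`K > 1` gives `E(K) ≥ w·(E(m_j)/w)^(2^j)` for every `j` (induction: `(E(m_{j+1})/w)² ≤ E(m_j)/w`). -/
theorem orbit_floor {E : ℝ → ℝ} {w : ℝ} (hw : 0 < w)
    (hA : ∀ m : ℝ, 1 < m → E m ^ 2 ≤ w * E (2 * m - 1)) {K : ℝ} (hK : 1 < K) (j : ℕ) :
    w * (E (1 + (K - 1) / 2 ^ j) / w) ^ 2 ^ j ≤ E K := by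
  induction j with
  | zero =>
    have e : 1 + (K - 1) / 2 ^ 0 = K := by rw [pow_zero, div_one]; ring
    rw [e, pow_zero, pow_one, mul_div_cancel₀ _ hw.ne']
  | succ j ih =>
    have hpos : 0 < (K - 1) / 2 ^ (j + 1) := div_pos (by linarith) (pow_pos two_pos _)
    have e1 : 2 * (1 + (K - 1) / 2 ^ (j + 1)) - 1 = 1 + (K - 1) / 2 ^ j := by
      rw [pow_succ]; field_simp; ring
    have hAP := hA (1 + (K - 1) / 2 ^ (j + 1)) (by linarith)
    rw [e1] at hAP
    have hsq : (E (1 + (K - 1) / 2 ^ (j + 1)) / w) ^ 2 ≤ E (1 + (K - 1) / 2 ^ j) / w := by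
      rw [div_pow, div_le_div_iff₀ (pow_pos hw 2) hw]
      nlinarith [hAP, hw]
    have hpow : (E (1 + (K - 1) / 2 ^ (j + 1)) / w) ^ 2 ^ (j + 1) ≤
        (E (1 + (K - 1) / 2 ^ j) / w) ^ 2 ^ j := by
      rw [show (2 : ℕ) ^ (j + 1) = 2 * 2 ^ j from pow_succ' 2 j, pow_mul]
      exact pow_le_pow_left₀ (sq_nonneg _) hsq _
    exact (mul_le_mul_of_nonneg_left hpow hw.le).trans ih

/-- **Exponential floor (abstract, sharp constant).** If in addition `E(m) ≥ w − s(m−1)` on `[1,∞)` for some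
`s ≥ 0` (a supporting line at the anchor value), then `E(K) ≥ w·exp(−(s/w)(K−1))` for every `K > 1`:
the orbit floor with `E(m_j)/w ≥ 1 − a/2^j`, `a := (s/w)(K−1)`, and `(1 − a/2^j)^(2^j) → exp(−a)`. -/
theorem exp_floor {E : ℝ → ℝ} {w s : ℝ} (hw : 0 < w) (hs : 0 ≤ s)
    (hlin : ∀ m : ℝ, 1 ≤ m → w - s * (m - 1) ≤ E m)
    (hA : ∀ m : ℝ, 1 < m → E m ^ 2 ≤ w * E (2 * m - 1)) {K : ℝ} (hK : 1 < K) :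
    w * Real.exp (-(s / w * (K - 1))) ≤ E K := by
  obtain ⟨a, ha⟩ : ∃ a : ℝ, a = s / w * (K - 1) := ⟨_, rfl⟩
  have ha0 : 0 ≤ a := by rw [ha]; exact mul_nonneg (div_nonneg hs hw.le) (by linarith)
  rw [← ha]
  -- the model sequence and its limit
  have hlim : Tendsto (fun j : ℕ => w * (1 + -a / ((2 ^ j : ℕ) : ℝ)) ^ 2 ^ j) atTop
      (𝓝 (w * Real.exp (-a))) :=
    ((Real.tendsto_one_add_div_pow_exp (-a)).comp
      (tendsto_pow_atTop_atTop_of_one_lt (by norm_num : (1 : ℕ) < 2))).const_mul w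
  -- eventually (once `a ≤ 2^j`) the model sequence is below `E K`, by the orbit floor
  obtain ⟨j₀, hj₀⟩ := pow_unbounded_of_one_lt a (by norm_num : (1 : ℝ) < 2)
  refine le_of_tendsto hlim (eventually_atTop.2 ⟨j₀, fun j hj => ?_⟩)
  have h2j : (0 : ℝ) < 2 ^ j := pow_pos two_pos j
  have haj : a ≤ 2 ^ j := hj₀.le.trans (pow_le_pow_right₀ one_le_two hj)
  have hcast : ((2 ^ j : ℕ) : ℝ) = 2 ^ j := by push_cast; ring
  rw [hcast]
  have hm1 : 1 ≤ 1 + (K - 1) / 2 ^ j := by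
    have := div_pos (sub_pos.2 hK) h2j
    linarith
  have hbase : 1 + -a / 2 ^ j ≤ E (1 + (K - 1) / 2 ^ j) / w := by
    rw [le_div_iff₀ hw]
    have h := hlin (1 + (K - 1) / 2 ^ j) hm1
    have e : (1 + -a / 2 ^ j) * w = w - s * (1 + (K - 1) / 2 ^ j - 1) := by
      rw [ha]; field_simp; ring
    rw [e]; exact h
  have hb0 : 0 ≤ 1 + -a / 2 ^ j := by
    rw [neg_div, ← sub_eq_add_neg, sub_nonneg, div_le_one h2j]; exact haj
  calc w * (1 + -a / 2 ^ j) ^ 2 ^ j ≤ w * (E (1 + (K - 1) / 2 ^ j) / w) ^ 2 ^ j :=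
        mul_le_mul_of_nonneg_left (pow_le_pow_left₀ hb0 hbase _) hw.le
    _ ≤ E K := orbit_floor hw hA hK j

/-- **Geometric sequences sit under exponential profiles.** For `w > 0`, `L ≥ 0` and `k ≥ 1`:
`(exp(−L)·min(1,w))^k ≤ w·exp(−L(k−1))` — the elementary comparison that turns an exponential floor into the
failure of superexponential contact (used by `closes_expCut` and by the exponential world of §3). -/
theorem geom_le_expProfile {w L : ℝ} (hw : 0 < w) (hL : 0 ≤ L) {k : ℕ} (hk : 1 ≤ k) :
    (Real.exp (-L) * min 1 w) ^ k ≤ w * Real.exp (-(L * ((k : ℝ) - 1))) := by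
  have hmin0 : 0 < min 1 w := lt_min one_pos hw
  have hmin : (min 1 w) ^ k ≤ w :=
    calc (min 1 w) ^ k ≤ (min 1 w) ^ 1 := pow_le_pow_of_le_one hmin0.le (min_le_left _ _) hk
      _ ≤ w := by rw [pow_one]; exact min_le_right _ _
  have hexp : Real.exp (-L) ^ k ≤ Real.exp (-(L * ((k : ℝ) - 1))) := by
    rw [← Real.exp_nat_mul, Real.exp_le_exp]
    nlinarith
  rw [mul_pow]
  calc Real.exp (-L) ^ k * (min 1 w) ^ k ≤ Real.exp (-(L * ((k : ℝ) - 1))) * w :=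
        mul_le_mul hexp hmin (pow_nonneg hmin0.le k) (Real.exp_pos _).le
    _ = w * Real.exp (-(L * ((k : ℝ) - 1))) := mul_comm _ _

/-! ## §1 The floor under the crux `AnchoredLogConvexity` -/

/-- **The anchor line.** `e(m) ≥ (ω−2) − (3−ω)(m−1)` for every real `m ≥ 1`: the Lotti–Romani chord from
the anchor `ω(1,0,1) = 2` to the shape `(1,m,1)`, read at the square (`ω ≤ (1−1/m)·2 + (1/m)·ω(1,m,1)`),
i.e. the supporting line of the convex profile at the square, continued beyond it. -/
theorem anchorLine_le_excess {m : ℝ} (hm : 1 ≤ m) :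
    (omega ℂ - 2) - (3 - omega ℂ) * (m - 1) ≤ omegaRect ℂ 1 m 1 - (m + 1) := by
  have hm0 : 0 < m := by linarith
  have ha : 0 ≤ 1 - 1 / m := by rw [sub_nonneg, div_le_one hm0]; exact hm
  have hb : (0 : ℝ) ≤ 1 / m := by positivity
  have h := LottiRomani1983_convexComb_le ℂ (x := 1) (y := 0) (z := 1) (x' := 1) (y' := m) (z' := 1)
    (a := 1 - 1 / m) (b := 1 / m) zero_le_one le_rfl zero_le_one zero_le_one hm0.le zero_le_one ha hb
  have e1 : (1 - 1 / m) * 1 + 1 / m * 1 = (1 : ℝ) := by ring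
  have e2 : (1 - 1 / m) * 0 + 1 / m * m = (1 : ℝ) := by
    rw [mul_zero, zero_add, one_div, inv_mul_cancel₀ hm0.ne']
  rw [e1, e2, omegaRect_one_one_one, omegaRect_one_zero_one] at h
  have h' : m * omega ℂ ≤ 2 * (m - 1) + omegaRect ℂ 1 m 1 := by
    have h2 := mul_le_mul_of_nonneg_left h hm0.le
    have e3 : m * ((1 - 1 / m) * 2 + 1 / m * omegaRect ℂ 1 m 1) = 2 * (m - 1) + omegaRect ℂ 1 m 1 := by
      field_simp
    linarith [e3]
  linarith

/-- **EXPONENTIAL FLOOR under the crux (PROVED).** `AnchoredLogConvexity ∧ ω > 2 ⟹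
e(K) ≥ (ω−2)·exp(−((3−ω)/(ω−2))·(K−1))` for every real `K > 1`: in a world with `ω > 2` the anchored
law caps the DECAY RATE of the excess by `λ* = (3−ω)/(ω−2)` (sharp, §3).  Equivalently: the law turns any
decay of `e` faster than every exponential into `ω = 2` (§2). -/
theorem expFloor_of_alc (hA : AnchoredLogConvexity) (hω : 2 < omega ℂ) {K : ℝ} (hK : 1 < K) :
    (omega ℂ - 2) * Real.exp (-((3 - omega ℂ) / (omega ℂ - 2) * (K - 1))) ≤
      omegaRect ℂ 1 K 1 - (K + 1) := by
  have hw : 0 < omega ℂ - 2 := sub_pos.2 hω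
  refine exp_floor (E := fun m => omegaRect ℂ 1 m 1 - (m + 1)) hw
    (by linarith [omega_le_three' (K := ℂ)]) (fun m hm => anchorLine_le_excess hm) (fun m hm => ?_) hK
  have h := hA m hm
  rw [omegaRect_one_one_one] at h
  have e : (2 : ℝ) * m - 1 + 1 = 2 * m := by ring
  show (omegaRect ℂ 1 m 1 - (m + 1)) ^ 2 ≤ (omega ℂ - 2) * (omegaRect ℂ 1 (2 * m - 1) 1 - (2 * m - 1 + 1))
  rw [e]; exact h

/-- The floor in LIMINF form: under the law, `ω > 2` gives constants `c, r > 0` with `e(k) ≥ c·r^k` at EVERY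
integer `k ≥ 1` — the excess is bounded below by a geometric sequence, `liminf e(k)^{1/k} ≥ r > 0`. -/
theorem geometric_floor_of_alc (hA : AnchoredLogConvexity) (hω : 2 < omega ℂ) :
    ∃ c r : ℝ, 0 < c ∧ 0 < r ∧ ∀ k : ℕ, 1 ≤ k → c * r ^ k ≤ omegaRect ℂ 1 k 1 - (k + 1) := by
  have hw : 0 < omega ℂ - 2 := sub_pos.2 hω
  have hL0 : 0 ≤ (3 - omega ℂ) / (omega ℂ - 2) :=
    div_nonneg (by linarith [omega_le_three' (K := ℂ)]) hw.le
  refine ⟨1, Real.exp (-((3 - omega ℂ) / (omega ℂ - 2))) * min 1 (omega ℂ - 2), one_pos,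
    mul_pos (Real.exp_pos _) (lt_min one_pos hw), fun k hk => ?_⟩
  rw [one_mul]
  rcases Nat.lt_or_ge 1 k with hk1 | hk1
  · have hk1' : (1 : ℝ) < k := by exact_mod_cast hk1
    exact (geom_le_expProfile hw hL0 hk).trans (expFloor_of_alc hA hω hk1')
  · have hk_eq : k = 1 := le_antisymm hk1 hk
    subst hk_eq
    have h1 : (Real.exp (-((3 - omega ℂ) / (omega ℂ - 2))) * min 1 (omega ℂ - 2)) ^ 1 ≤
        1 * min 1 (omega ℂ - 2) := by
      rw [pow_one]
      exact mul_le_mul_of_nonneg_right (Real.exp_le_one_iff.2 (by linarith)) (lt_min one_pos hw).le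
    have h2 : min 1 (omega ℂ - 2) ≤ omega ℂ - 2 := min_le_right _ _
    push_cast
    rw [omegaRect_one_one_one]
    linarith

/-! ## §2 The deeper cut B′: `ω = 2 ⟺ SuperExpContact ∧ AnchoredLogConvexity` -/

/-- Cut A ⟹ cut B′ on the special side: a far zero is superexponential contact (`e(k) = 0 < ρ^k`). -/
theorem superExpContact_of_finiteSaturation (h : FiniteSaturation) : SuperExpContact := by
  obtain ⟨k, hk, hs⟩ := h
  intro ρ hρ
  exact ⟨k, hk, by rw [hs, sub_self]; exact pow_pos hρ k⟩

/-- Necessity of the new special leaf: `ω = 2 → SuperExpContact`. -/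
theorem superExpContact_of_mm (h : _root_.MatrixMultiplication) : SuperExpContact :=
  superExpContact_of_finiteSaturation (finiteSaturation_of_mm h)

/-- Cut B ⟹ cut B′ on the generic side: the real three-term law `e(k)² ≤ e(k−h)·e(k+h)` contains the anchored
law as its slice `h = m − 1` (so B′ also dominates the gen-6 cut `SuperExpContact ∧ RealLogConvexity`). -/
theorem anchored_of_realLogConvexity (h : RealLogConvexity) : AnchoredLogConvexity := by
  intro m hm
  have key := h m (m - 1) (by linarith) (by norm_num)
  have e1 : m - (m - 1) = 1 := by ring
  have e2 : m + (m - 1) = 2 * m - 1 := by ring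
  rw [e1, e2] at key
  have e3 : (2 : ℝ) * m - 1 + 1 = 2 * m := by ring
  rw [e3, show (1 : ℝ) + 1 = 2 by norm_num] at key
  exact key

/-- **DECIDING THEOREM of cut B′ (PROVED).** `SuperExpContact → AnchoredLogConvexity → ω(ℂ) = 2`.
If `ω > 2`, the exponential floor (§1) and `geom_le_expProfile` give `ρ^k ≤ e(k)` for EVERY `k ≥ 2` at
`ρ := exp(−(3−ω)/(ω−2))·min(1, ω−2) > 0`, contradicting superexponential contact at that `ρ`. -/
theorem closes_expCut (h₁ : SuperExpContact) (h₂ : AnchoredLogConvexity) : _root_.MatrixMultiplication := by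
  rw [_root_.MatrixMultiplication_iff]
  refine le_antisymm ?_ (omega_two_le (K := ℂ))
  by_contra hω
  rw [not_le] at hω
  have hw : 0 < omega ℂ - 2 := sub_pos.2 hω
  obtain ⟨L, hL⟩ : ∃ L : ℝ, L = (3 - omega ℂ) / (omega ℂ - 2) := ⟨_, rfl⟩
  have hL0 : 0 ≤ L := by
    rw [hL]; exact div_nonneg (by linarith [omega_le_three' (K := ℂ)]) hw.le
  obtain ⟨k, hk, hek⟩ := h₁ (Real.exp (-L) * min 1 (omega ℂ - 2))
    (mul_pos (Real.exp_pos _) (lt_min one_pos hw))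
  have hk1 : (1 : ℝ) < k := by exact_mod_cast (by omega : 1 < k)
  have hfloor := expFloor_of_alc h₂ hω hk1
  rw [← hL] at hfloor
  have hgeom := geom_le_expProfile hw hL0 (k := k) (by omega)
  linarith

/-- **Cut B′ is exact**: `ω(ℂ) = 2 ⟺ SuperExpContact ∧ AnchoredLogConvexity` — same generic leaf as the node
of record, special leaf weakened from a far ZERO to superexponential CONTACT. -/
theorem node_expCut_iff : _root_.MatrixMultiplication ↔ SuperExpContact ∧ AnchoredLogConvexity :=
  ⟨fun h => ⟨superExpContact_of_mm h, anchoredLogConvexity_of_mm h⟩, fun h => closes_expCut h.1 h.2⟩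

/-- The partial order of cuts, special side: cut A's hypotheses give cut B′'s. -/
theorem cutA_implies_cutB' (h : FiniteSaturation ∧ AnchoredLogConvexity) :
    SuperExpContact ∧ AnchoredLogConvexity :=
  ⟨superExpContact_of_finiteSaturation h.1, h.2⟩

/-- The partial order of cuts, generic side: the gen-6 cut B's hypotheses give cut B′'s. -/
theorem cutB_implies_cutB' (h : SuperExpContact ∧ RealLogConvexity) :
    SuperExpContact ∧ AnchoredLogConvexity :=
  ⟨h.1, anchored_of_realLogConvexity h.2⟩

/-! ## §3 Rungs and sharpness -/

/-- **FIRST RUNG of the special leaf (PROVED from tree data).** `SuperExpContact` holds at every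
`ρ > √(log 2 / log 6)` (`≈ 0.622`): witness `k = 2`, `e(2) ≤ log 2/log 6 < ρ²` by the landed aside `LogRate`
(first-power `CW_6`).  The leaf asks for this at every `ρ > 0`; each fixed `k` caps the reachable `ρ` at
`e(k)^{1/k}`, so the ladder is an order-of-contact ladder. -/
theorem superExpContact_rung {ρ : ℝ} (hρ : Real.sqrt (Real.log 2 / Real.log 6) < ρ) :
    ∃ k : ℕ, 2 ≤ k ∧ omegaRect ℂ 1 k 1 - (k + 1) < ρ ^ k := by
  refine ⟨2, le_rfl, ?_⟩
  have h := FarEdgeDescentLogRate.logRate 2 (by norm_num)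
  push_cast at h ⊢
  have h6 : Real.log (2 * 2 + 2 : ℝ) = Real.log 6 := by norm_num
  rw [h6] at h
  have hρ0 : 0 < ρ := lt_of_le_of_lt (Real.sqrt_nonneg _) hρ
  have hsq : Real.log 2 / Real.log 6 < ρ ^ 2 := (Real.sqrt_lt' hρ0).1 hρ
  linarith

/-- **Exponential world: the anchored law holds with EQUALITY.** For `E(x) = w·exp(−λ(x−1))`:
`E(m)² = w·E(2m−1)` identically — so the floor of §1 (the case `λ = (3−ω)/(ω−2)`, where this world IS the
floor and sits on the anchor line by `exp(−t) ≥ 1 − t`) cannot be improved from the law and the anchor line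
alone. -/
theorem expWorld_law_eq (w lam m : ℝ) :
    (w * Real.exp (-(lam * (m - 1)))) ^ 2 = w * (w * Real.exp (-(lam * (2 * m - 1 - 1)))) := by
  have e : -(lam * (m - 1)) + -(lam * (m - 1)) = -(lam * (2 * m - 1 - 1)) := by ring
  rw [mul_pow, sq (Real.exp _), ← Real.exp_add, e]
  ring

/-- **Exponential world: no superexponential contact.** Every profile `E(k) = w·exp(−λ(k−1))` (`w > 0`,
`λ ≥ 0`) dominates a geometric sequence, so the `SuperExpContact`-shape statement FAILS for it: with
`expWorld_law_eq`: from the profile facts used in §2 (anchor line, anchored law) NO fixed-rate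
contact statement can replace the special leaf — `SuperExpContact` (all rates) is the minimal contact rung
that closes against the anchored law. -/
theorem expWorld_noContact {w lam : ℝ} (hw : 0 < w) (hlam : 0 ≤ lam) :
    ∃ ρ : ℝ, 0 < ρ ∧ ∀ k : ℕ, 2 ≤ k → ρ ^ k ≤ w * Real.exp (-(lam * ((k : ℝ) - 1))) :=
  ⟨Real.exp (-lam) * min 1 w, mul_pos (Real.exp_pos _) (lt_min one_pos hw),
    fun k hk => geom_le_expProfile hw hlam (by omega)⟩

/-- **Gaussian world: superexponential contact WITHOUT a zero.** The profile `E(k) = w·exp(−(k²−1))`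
(`w ≤ 1`) satisfies the `SuperExpContact`-shape statement … -/
theorem gaussWorld_contact {w : ℝ} (hw1 : w ≤ 1) :
    ∀ ρ : ℝ, 0 < ρ → ∃ k : ℕ, 2 ≤ k ∧ w * Real.exp (-(((k : ℕ) : ℝ) ^ 2 - 1)) < ρ ^ k := by
  intro ρ hρ
  obtain ⟨n, hn⟩ := exists_nat_ge (-Real.log ρ)
  refine ⟨n + 2, by omega, ?_⟩
  have hn0 : (0 : ℝ) ≤ n := n.cast_nonneg
  have hprod : 0 ≤ ((n : ℝ) + 2) * (Real.log ρ + n) := mul_nonneg (by linarith) (by linarith)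
  have hlt : -((((n + 2 : ℕ) : ℝ)) ^ 2 - 1) < ((n + 2 : ℕ) : ℝ) * Real.log ρ := by
    push_cast
    nlinarith [hprod, hn0]
  have hexp : Real.exp (-((((n + 2 : ℕ) : ℝ)) ^ 2 - 1)) < ρ ^ (n + 2) := by
    have h := Real.exp_lt_exp.2 hlt
    rwa [Real.exp_nat_mul, Real.exp_log hρ] at h
  calc w * Real.exp (-((((n + 2 : ℕ) : ℝ)) ^ 2 - 1)) ≤ Real.exp (-((((n + 2 : ℕ) : ℝ)) ^ 2 - 1)) :=
        mul_le_of_le_one_left (Real.exp_pos _).le hw1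
    _ < ρ ^ (n + 2) := hexp

/-- … and is ZERO-FREE (`w > 0`): the `FiniteSaturation`-shape statement fails for it.  With `gaussWorld_contact`:
`SuperExpContact` is STRICTLY WEAKER than `FiniteSaturation` as a profile statement. -/
theorem gaussWorld_noZero {w : ℝ} (hw : 0 < w) (k : ℕ) : w * Real.exp (-(((k : ℕ) : ℝ) ^ 2 - 1)) ≠ 0 :=
  (mul_pos hw (Real.exp_pos _)).ne'

/-- … and it VIOLATES the anchored law (already at `m = 2`: `E(2)² = w²e^{−6} > w²e^{−8} = w·E(3)`), as it
must by §2: no world with `w > 0` carries both superexponential contact and the law. -/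
theorem gaussWorld_not_law {w : ℝ} (hw : 0 < w) :
    ¬ ∀ m : ℝ, 1 < m → (w * Real.exp (-(m ^ 2 - 1))) ^ 2 ≤ w * (w * Real.exp (-((2 * m - 1) ^ 2 - 1))) := by
  intro h
  have h2 := h 2 (by norm_num)
  norm_num at h2
  have e1 : Real.exp (-3 : ℝ) ^ 2 = Real.exp (-6) := by rw [← Real.exp_nat_mul]; norm_num
  rw [mul_pow, e1] at h2
  have hlt : Real.exp (-8 : ℝ) < Real.exp (-6) := Real.exp_lt_exp.2 (by norm_num)
  nlinarith [mul_pos hw hw, hlt, h2]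

end Summit.MatrixMultiplication.MatrixMultiplication.Theorems.FarEdgeDescentExpFloor

end
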